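import Literature.MathematicalPhysics.StatisticalMechanics.ComplexSpinChiralLRO
import HarnessLib

/-!
# Mean field is an upper bound: Salmhofer–Seiler's Theorem 4.3 (4.6) in every finite volume
# (CMP 139 (1991), Thm. 4.3 (4.6)–(4.7), (4.10)–(4.11), (3.55)–(3.56), Cor. 4.4 (2)–(3))

Fourteenth file of the Salmhofer–Seiler series; theorems only (no definition, no named fact).
The tree has the Schwinger–Dyson equation (3.46) at `L = 0` (`partitionFunction_eq_sd'`,
`ComplexSpinSchwingerDyson`), reflection positivity with the Schwarz inequality (3.54)
(`bracketC_schwarz`, `ComplexSpinReflectionPositivity`) and `Z_Λ > 0` (`partitionFunction_pos`,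
`ComplexSpinChiralLRO`).  Out of these the printed proof of Theorem 4.3's UPPER bound assembles in a
few lines, and — unlike the lower bound (4.8), which needs the thermodynamic limit and clustering
(Thms. 3.8, 3.11, 3.18 (2), 3.23; not formalised) — it holds verbatim in every finite even volume:

* `bracket_X_sq_le`, `expect_X_sq_le` — **(3.55)**: `⟨σ_x⟩_Λ² ≤ ⟨σ_x σ_{rx}⟩_Λ` for `x ∈ Λ₊`
  (Schwarz with `A = σ_x`, `B = 1`);
* `expect_X_siteReflect` — `⟨σ_{rx}⟩_Λ = ⟨σ_x⟩_Λ` (`[ΘΦ] = conj [Φ]`, real observables);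
* `expect_X_sq_le_nbr` — **(3.56) for each of the `2ν` neighbours**: `⟨σ_x⟩_Λ² ≤ ⟨σ_xσ_{x±e_μ}⟩_Λ`
  (the neighbour `x - e_μ` is the mirror image of `x` in the plane `k = x_μ`, and `x` is the mirror
  image of `x + e_μ` in the plane `k = x_μ + 1`; the print fixes `x₁ = L_μ/2` and uses one plane);
* `sd_nbr_sum_le` — **(3.61)/(4.10)** with the nonnegative remainder dropped:
  `2m[σ_x]_Λ + ∑_{|y-x|=1}[σ_xσ_y]_Λ ≤ Z_Λ` (`m ≥ 0`, `w₁ = 1`, `w_k ≥ 0`);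
* **`meanField_ineq`** — **Theorem 4.3 (4.6)–(4.7) via (4.11)**: `2ν⟨σ_x⟩_Λ² + 2m⟨σ_x⟩_Λ ≤ 1` for
  every complex spin system with `B = exp(NW)` to order `N`, `w₁ = 1`, `w_k ≥ 0` (Thm. 3.18's
  hypotheses), every `m ≥ 0`, every even torus and every site; **`expect_X_le_meanField`** —
  `⟨σ_x⟩_Λ ≤ s₁ = (√(m² + 2ν) - m)/(2ν)`, the positive root (3.20) of the mean-field equation (4.7)
  ("mean field theory, which neglects all fluctuations, is an upper bound", Cor. 4.4 (2));
* `expect_X_nonneg`, `expect_X_le_inv_sqrt`, `two_mul_mass_mul_expect_X_le_one`,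
  `condensate_le_min` — `0 ≤ ⟨σ_x⟩_Λ ≤ 1/√(2ν)` ((4.16), upper inequality) and **Cor. 4.4 (3)
  (4.18)**: `⟨ψ̄ψ⟩_Λ = 2N⟨σ_x⟩_Λ ≤ N min{√(2/ν), 1/m}`;
* `hasLog_njl` — the NJL system (`W(t) = t`: `a_k = N^k/k!`, `w = δ_{k1}`) satisfies `B = exp(NW)`;
  `njl_meanField_ineq`, `njl_expect_X_le_meanField` (the model of the printed Thm. 4.3: NJL /
  strongly coupled lattice QED), `uN_meanField_ineq`, `uN_expect_X_le_meanField` (`U(N)`, `N ≤ 4`).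

On the printed proof.  Salmhofer–Seiler derive (4.11) `1 = 2m⟨σ_x⟩ + 2ν⟨σ_xσ_{x-e₁}⟩` from (4.10)
by "the lattice rotational symmetry of the two-point function which holds because the thermodynamic
limit is unique for `m > 0`"; on the finite torus we instead bound each of the `2ν` neighbour terms
separately by (3.56) in its own reflection plane, so neither rotational symmetry nor the infinite
volume enters, and the inequality holds at `m = 0` too.  The LOWER bound (4.8)/(4.15)
(`⟨σ_x⟩ ≥ s₂`, chiral symmetry breaking for QED/NJL, Cor. 4.4 (1)) is NOT formalised: in finite
volume (4.13)–(4.14) bound `1 - 2m⟨σ_x⟩` by the zero mode `|Λ|⁻¹∑_y⟨σ_xσ_y⟩` (this is the tree's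
`chiralLRO_expect`, Thm. 4.8), and identifying that zero mode with `⟨σ_x⟩²` is exactly the clustering
of the infinite-volume state at `m > 0` (Thm. 3.11).  Honest framing: `β = 0` complex spin systems
(Salmhofer–Seiler's bosonised one-link integrals) on even tori; nothing about `β > 0`, the continuum,
`SU(N)` or the summit's `QCD` conjunct.

## References

* M. Salmhofer, E. Seiler, Commun. Math. Phys. 139 (1991) 395–432: (3.20), Remark 3.16 (3.54),
  (3.55)–(3.56), Thm. 3.18 (1) with (3.61), Thm. 4.3 (4.6)–(4.11), Cor. 4.4 (2)–(3) (4.16), (4.18).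
  [SalmhoferSeiler1991]
-/

noncomputable section

open MvPolynomial Finset
open Literature.Probability.LatticeModels
open Literature.Barriers.CriticalPhenomena.NonGibbs

namespace Literature.MathematicalPhysics.StatisticalMechanics

namespace ComplexSpin

variable {ν L : ℕ} [NeZero L]

/-! ### (3.55)–(3.56): `⟨σ_x⟩² ≤ ⟨σ_x σ_{rx}⟩` -/

/-- **(3.55)**: `[σ_x]_Λ² ≤ [σ_x σ_{rx}]_Λ · Z_Λ` for `x ∈ Λ₊` — the Schwarz inequality (3.54) with
`A = σ_x`, `B = 1` (`[1 Θ1] = Z`), for bond data `a_k ≥ 0`, on every even torus and for every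
reflection plane. [cite: SalmhoferSeiler1991, (3.55)] -/
theorem bracket_X_sq_le (hL : Even L) (i : Fin ν) (k : ZMod L) {N : ℕ} (m : ℝ) {a : ℕ → ℝ}
    (ha : ∀ j ≤ N, 0 ≤ a j) {x : TorusSite ν L} (hx : x ∈ halfPlus L i k) :
    bracket N m a (X x) ^ 2 ≤
      bracket N m a (X x * X (siteReflect i k x)) * partitionFunction (ν := ν) (L := L) N m a := by
  set f : ℕ → ℝ := fun j => (2 * N * m) ^ j / (Nat.factorial j : ℝ) with hf
  have hS := bracketC_schwarz hL i k f ha (X_mem_plusAlgebra hx) (Subalgebra.one_mem (plusAlgebra i k))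
  -- identify the three complex brackets with real ones
  have h1 : bracketC N f a ((X x : FieldAlg ν L) * reflect i k 1) = (bracket N m a (X x) : ℂ) := by
    rw [map_one, mul_one, bracket_eq_bracketC, map_X]
  have h2 : bracketC N f a ((X x : FieldAlg ν L) * reflect i k (X x)) =
      (bracket N m a (X x * X (siteReflect i k x)) : ℂ) := by
    rw [reflect_X, bracket_eq_bracketC, map_mul, map_X, map_X]
  have h3 : bracketC N f a ((1 : FieldAlg ν L) * reflect i k 1) =
      (partitionFunction (ν := ν) (L := L) N m a : ℂ) := by
    rw [map_one, mul_one, partitionFunction, bracket_eq_bracketC, map_one]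
  rw [h1, h2, h3, Complex.normSq_ofReal, Complex.ofReal_re, Complex.ofReal_re] at hS
  rw [sq]
  exact hS

/-- **(3.55)–(3.56) for expectations**: `⟨σ_x⟩_Λ² ≤ ⟨σ_x σ_{rx}⟩_Λ` (`x ∈ Λ₊`, `Z_Λ > 0`).
[cite: SalmhoferSeiler1991, (3.55)–(3.56)] -/
theorem expect_X_sq_le (hL : Even L) (i : Fin ν) (k : ZMod L) {N : ℕ} (m : ℝ) {a : ℕ → ℝ}
    (ha : ∀ j ≤ N, 0 ≤ a j) (hZ : 0 < partitionFunction (ν := ν) (L := L) N m a)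
    {x : TorusSite ν L} (hx : x ∈ halfPlus L i k) :
    expect N m a (X x) ^ 2 ≤ expect N m a (X x * X (siteReflect i k x)) := by
  have h := bracket_X_sq_le hL i k m ha hx
  rw [expect_eq_div, expect_eq_div, div_pow, div_le_div_iff₀ (by positivity) hZ]
  calc bracket N m a (X x) ^ 2 * partitionFunction N m a
      ≤ bracket N m a (X x * X (siteReflect i k x)) * partitionFunction N m a *
          partitionFunction N m a := mul_le_mul_of_nonneg_right h hZ.le
    _ = bracket N m a (X x * X (siteReflect i k x)) * partitionFunction N m a ^ 2 := by ring

/-! ### Reflection invariance of the state and the two neighbours of a site as mirror images -/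

/-- `[ΘΦ]_Λ = [Φ]_Λ` for real observables (the real form of `[ΘΦ] = conj [Φ]`).
[cite: SalmhoferSeiler1991, Remark 3.16] -/
theorem bracket_reflectR (i : Fin ν) (k : ZMod L) (N : ℕ) (m : ℝ) (a : ℕ → ℝ)
    (Φ : MvPolynomial (TorusSite ν L) ℝ) :
    bracket N m a (reflectR i k Φ) = bracket N m a Φ := by
  have h := bracket_eq_bracketC (ν := ν) (L := L) N m a (reflectR i k Φ)
  rw [map_reflectR, bracketC_reflect, ← bracket_eq_bracketC, Complex.conj_ofReal] at h
  exact_mod_cast h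

/-- `⟨σ_{rx}⟩_Λ = ⟨σ_x⟩_Λ`. [cite: SalmhoferSeiler1991, Remark 3.16] -/
theorem expect_X_siteReflect (i : Fin ν) (k : ZMod L) (N : ℕ) (m : ℝ) (a : ℕ → ℝ)
    (x : TorusSite ν L) :
    expect N m a (X (siteReflect i k x)) = expect N m a (X x) := by
  rw [expect_eq_div, expect_eq_div, ← bracket_reflectR i k N m a (X x), reflectR_apply, rename_X]

/-- The plane `k = x_μ` in direction `μ`: `x ∈ Λ₊` (it is adjacent to the plane) …
[cite: SalmhoferSeiler1991, (3.56) ("let `x₁ = L_μ/2`, then `rx = x - e₁`")] -/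
theorem mem_halfPlus_self (hL2 : 2 ≤ L) (μ : Fin ν) (x : TorusSite ν L) :
    x ∈ halfPlus L μ (x μ) := by
  rw [mem_halfPlus, sub_self, ZMod.val_zero]
  exact Nat.div_pos hL2 two_pos

omit [NeZero L] in
/-- … and its mirror image is `rx = x - e_μ`. [cite: SalmhoferSeiler1991, (3.56)] -/
theorem siteReflect_self (μ : Fin ν) (x : TorusSite ν L) :
    siteReflect μ (x μ) x = x - Pi.single μ 1 := by
  ext j
  by_cases hj : j = μ
  · subst hj
    rw [siteReflect_apply_same, Pi.sub_apply, Pi.single_eq_same]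
    ring
  · rw [siteReflect_apply_of_ne _ _ _ hj, Pi.sub_apply, Pi.single_eq_of_ne hj, sub_zero]

omit [NeZero L] in
/-- The plane `k = x_μ + 1`: the mirror image of `x + e_μ` is `x`. [cite: SalmhoferSeiler1991, (3.56)] -/
theorem siteReflect_succ_add_single (μ : Fin ν) (x : TorusSite ν L) :
    siteReflect μ (x μ + 1) (x + Pi.single μ 1) = x := by
  ext j
  by_cases hj : j = μ
  · subst hj
    rw [siteReflect_apply_same, Pi.add_apply, Pi.single_eq_same]
    ring
  · rw [siteReflect_apply_of_ne _ _ _ hj, Pi.add_apply, Pi.single_eq_of_ne hj, add_zero]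

/-- **(3.56) for both neighbours in every direction**: `⟨σ_x⟩² ≤ ⟨σ_x σ_{x-e_μ}⟩` and
`⟨σ_x⟩² ≤ ⟨σ_x σ_{x+e_μ}⟩` (`a_k ≥ 0`, `Z_Λ > 0`, even `L ≥ 2`). [cite: SalmhoferSeiler1991, (3.56)] -/
theorem expect_X_sq_le_nbr (hL : Even L) (hL2 : 2 ≤ L) {N : ℕ} (m : ℝ) {a : ℕ → ℝ}
    (ha : ∀ j ≤ N, 0 ≤ a j) (hZ : 0 < partitionFunction (ν := ν) (L := L) N m a)
    (x : TorusSite ν L) (s : Fin ν × Bool) :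
    expect N m a (X x) ^ 2 ≤ expect N m a (X x * X (nbr x s)) := by
  obtain ⟨μ, b⟩ := s
  cases b
  · -- `nbr x (μ, false) = x - e_μ = r x` for the plane `k = x_μ`
    have h := expect_X_sq_le hL μ (x μ) m ha hZ (mem_halfPlus_self hL2 μ x)
    rw [siteReflect_self] at h
    simpa [nbr] using h
  · -- `nbr x (μ, true) = x + e_μ =: y`; `y ∈ Λ₊` for the plane `k = x_μ + 1`, and `r y = x`
    have hyμ : (x + Pi.single μ 1 : TorusSite ν L) μ = x μ + 1 := by
      rw [Pi.add_apply, Pi.single_eq_same]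
    have hmem : x + Pi.single μ 1 ∈ halfPlus L μ (x μ + 1) := by
      have := mem_halfPlus_self hL2 μ (x + Pi.single μ 1)
      rwa [hyμ] at this
    have h := expect_X_sq_le hL μ (x μ + 1) m ha hZ hmem
    have hxy : expect N m a (X (x + Pi.single μ 1)) = expect N m a (X x) := by
      rw [← expect_X_siteReflect μ (x μ + 1) N m a (x + Pi.single μ 1), siteReflect_succ_add_single]
    rw [siteReflect_succ_add_single, hxy, mul_comm] at h
    simpa [nbr] using h

/-! ### The SD equation at `L = 0`, lower form -/

/-- **(3.61)/(4.10) with `ρ ≥ 0` dropped**: for `m ≥ 0`, `B = exp(NW)` to order `N`, `w₁ = 1`,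
`w_k ≥ 0`: `2m[σ_x]_Λ + ∑_{y:|y-x|=1}[σ_xσ_y]_Λ ≤ Z_Λ` (the terms `k w_k[(σ_xσ_y)^k]`, `k ≥ 2`, of the
SD equation (3.46) are nonnegative; for the NJL system they vanish and this is the equality (4.10)).
[cite: SalmhoferSeiler1991, (3.61) and (4.10)] -/
theorem sd_nbr_sum_le (hL2 : 2 ≤ L) {N : ℕ} (hN : 1 ≤ N) {a w : ℕ → ℝ} (hlog : HasLog N a w)
    (ha0 : a 0 = 1) (hw1 : w 1 = 1) (hw : ∀ k, 2 ≤ k → k ≤ N → 0 ≤ w k) {m : ℝ} (hm : 0 ≤ m)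
    (x : TorusSite ν L) :
    2 * m * bracket N m a (X x) + ∑ s : Fin ν × Bool, bracket N m a (X x * X (nbr x s)) ≤
      partitionFunction (ν := ν) (L := L) N m a := by
  have hw' : ∀ k, 1 ≤ k → k ≤ N → 0 ≤ w k := by
    intro k hk1 hkN
    rcases Nat.lt_or_ge k 2 with hk | hk
    · rw [show k = 1 by omega, hw1]; exact zero_le_one
    · exact hw k hk hkN
  have ha := hlog.coeff_nonneg ha0 hw'
  rw [partitionFunction_eq_sd' hN hlog hL2 m x]
  refine add_le_add le_rfl (Finset.sum_le_sum fun s _ => ?_)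
  have h1 : bracket N m a (X x * X (nbr x s)) =
      ((1 : ℕ) : ℝ) * w 1 * bracket N m a ((X x * X (nbr x s)) ^ 1) := by
    rw [hw1, pow_one, Nat.cast_one, one_mul, one_mul]
  rw [h1]
  refine Finset.single_le_sum
    (f := fun k : ℕ => (k : ℝ) * w k * bracket N m a ((X x * X (nbr x s)) ^ k)) (fun k hk => ?_)
    (Finset.mem_range.2 (by omega : 1 < N + 1))
  rcases Nat.eq_zero_or_pos k with rfl | hk1
  · simp
  · exact mul_nonneg (mul_nonneg (Nat.cast_nonneg k)
      (hw' k hk1 (by have := Finset.mem_range.1 hk; omega)))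
      (bracket_nonneg N hm ha (((NonnegCoeff.X x).mul (NonnegCoeff.X _)).pow k))

/-! ### Theorem 4.3 (4.6): mean field is an upper bound, in every finite volume -/

/-- **Theorem 4.3, (4.6)–(4.7) with (4.11), in finite volume**: for a complex spin system with
`B = exp(NW)` to order `N`, `w₁ = 1`, `w_k ≥ 0` (the hypotheses of Thm. 3.18: the `U(N)` models,
`N ≤ 5`, and the NJL system / strongly coupled QED), every `m ≥ 0`, every even torus `Λ = (ℤ/L)^ν`
(`L ≥ 2`, `ν ≥ 1`) and every site `x`:
`2ν⟨σ_x⟩_Λ² + 2m⟨σ_x⟩_Λ ≤ 1`, i.e. `⟨σ_x⟩_Λ` lies below the positive root `s₁` of the mean-field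
equation `2νs² + 2ms - 1 = 0` (`expect_X_le_meanField`).  Printed proof, followed here: the SD
equation at `L = 0`, `1 - 2m⟨σ_x⟩ = ∑_{|y-x|=1}⟨σ_xσ_y⟩ (+ρ, ρ ≥ 0)` (4.10)/(3.61), and the
reflection-positivity Schwarz inequality `⟨σ_xσ_{x∓e_μ}⟩ ≥ ⟨σ_x⟩²` (3.56) for each of the `2ν`
neighbours (the print uses lattice rotational symmetry of the infinite-volume state to reduce to one
neighbour; on the torus each neighbour is the mirror image of `x` in its own reflection plane, so no
symmetry argument and no thermodynamic limit is needed). [cite: SalmhoferSeiler1991, Thm. 4.3 (4.6)–(4.7), (4.10)–(4.11)] -/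
theorem meanField_ineq (hν : 1 ≤ ν) (hL : Even L) (hL2 : 2 ≤ L) {N : ℕ} (hN : 1 ≤ N)
    {a w : ℕ → ℝ} (hlog : HasLog N a w) (ha0 : a 0 = 1) (hw1 : w 1 = 1)
    (hw : ∀ k, 2 ≤ k → k ≤ N → 0 ≤ w k) {m : ℝ} (hm : 0 ≤ m) (x : TorusSite ν L) :
    2 * ν * expect N m a (X x) ^ 2 + 2 * m * expect N m a (X x) ≤ 1 := by
  have hw' : ∀ k, 1 ≤ k → k ≤ N → 0 ≤ w k := by
    intro k hk1 hkN
    rcases Nat.lt_or_ge k 2 with hk | hk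
    · rw [show k = 1 by omega, hw1]; exact zero_le_one
    · exact hw k hk hkN
  have ha := hlog.coeff_nonneg ha0 hw'
  have hapos := hlog.coeff_pos hN ha0 hw1 hw
  have hZ : 0 < partitionFunction (ν := ν) (L := L) N m a :=
    partitionFunction_pos hL.two_dvd hL2 hν hm ha (hapos 0 (Nat.zero_le N)) (hapos N le_rfl)
  have hsd := sd_nbr_sum_le hL2 hN hlog ha0 hw1 hw hm x
  -- divide the SD inequality by `Z > 0`
  have h1 : 2 * m * expect N m a (X x) + ∑ s : Fin ν × Bool, expect N m a (X x * X (nbr x s)) ≤ 1 := by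
    have h := (div_le_one hZ).2 hsd
    simp only [expect_eq_div]
    rwa [add_div, mul_div_assoc, Finset.sum_div] at h
  -- each neighbour term is at least `⟨σ_x⟩²`
  have h2 : 2 * (ν : ℝ) * expect N m a (X x) ^ 2 ≤
      ∑ s : Fin ν × Bool, expect N m a (X x * X (nbr x s)) := by
    calc 2 * (ν : ℝ) * expect N m a (X x) ^ 2 = ∑ _s : Fin ν × Bool, expect N m a (X x) ^ 2 := by
          rw [Finset.sum_const, Finset.card_univ, Fintype.card_prod, Fintype.card_fin,
            Fintype.card_bool, nsmul_eq_mul]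
          push_cast
          ring
      _ ≤ ∑ s : Fin ν × Bool, expect N m a (X x * X (nbr x s)) :=
          Finset.sum_le_sum fun s _ => expect_X_sq_le_nbr hL hL2 m ha hZ x s
  linarith

/-- **Theorem 4.3 (4.6): `⟨σ_x⟩_Λ ≤ s₁ = (√(m² + 2ν) - m)/(2ν)`**, the positive solution (3.20) of
the mean-field equation (4.7) `2νs₁² + 2ms₁ - 1 = 0` ("mean field theory, which neglects all
fluctuations, is an upper bound for `⟨ψ̄ψ⟩`", Cor. 4.4 (2)) — in every finite even volume, at every
site, for every `m ≥ 0`. [cite: SalmhoferSeiler1991, Thm. 4.3 (4.6)–(4.7) with (3.20); Cor. 4.4 (2)] -/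
theorem expect_X_le_meanField (hν : 1 ≤ ν) (hL : Even L) (hL2 : 2 ≤ L) {N : ℕ} (hN : 1 ≤ N)
    {a w : ℕ → ℝ} (hlog : HasLog N a w) (ha0 : a 0 = 1) (hw1 : w 1 = 1)
    (hw : ∀ k, 2 ≤ k → k ≤ N → 0 ≤ w k) {m : ℝ} (hm : 0 ≤ m) (x : TorusSite ν L) :
    expect N m a (X x) ≤ (Real.sqrt (m ^ 2 + 2 * ν) - m) / (2 * ν) := by
  have h := meanField_ineq hν hL hL2 hN hlog ha0 hw1 hw hm x
  set s : ℝ := expect N m a (X x) with hs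
  have hν0 : (0 : ℝ) < ν := by exact_mod_cast hν
  have hsq : (2 * ν * s + m) ^ 2 ≤ m ^ 2 + 2 * ν := by nlinarith
  have hle : 2 * ν * s + m ≤ Real.sqrt (m ^ 2 + 2 * ν) :=
    (le_abs_self _).trans (Real.abs_le_sqrt hsq)
  rw [le_div_iff₀ (by positivity)]
  linarith

/-- `⟨σ_x⟩_Λ ≥ 0` (Thm. 3.18 (1), lower half, for `σ^L = σ_x`). [cite: SalmhoferSeiler1991, Thm. 3.18 (1) (3.59)] -/
theorem expect_X_nonneg (hν : 1 ≤ ν) (hL : Even L) (hL2 : 2 ≤ L) {N : ℕ} (hN : 1 ≤ N)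
    {a w : ℕ → ℝ} (hlog : HasLog N a w) (ha0 : a 0 = 1) (hw1 : w 1 = 1)
    (hw : ∀ k, 2 ≤ k → k ≤ N → 0 ≤ w k) {m : ℝ} (hm : 0 ≤ m) (x : TorusSite ν L) :
    0 ≤ expect N m a (X x) := by
  have hw' : ∀ k, 1 ≤ k → k ≤ N → 0 ≤ w k := by
    intro k hk1 hkN
    rcases Nat.lt_or_ge k 2 with hk | hk
    · rw [show k = 1 by omega, hw1]; exact zero_le_one
    · exact hw k hk hkN
  have ha := hlog.coeff_nonneg ha0 hw'
  have hapos := hlog.coeff_pos hN ha0 hw1 hw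
  have hZ : 0 < partitionFunction (ν := ν) (L := L) N m a :=
    partitionFunction_pos hL.two_dvd hL2 hν hm ha (hapos 0 (Nat.zero_le N)) (hapos N le_rfl)
  rw [expect_eq_div]
  exact div_nonneg (bracket_nonneg N hm ha (NonnegCoeff.X x)) hZ.le

/-- **(4.16), upper inequality / (4.18) at every `m ≥ 0`: `⟨σ_x⟩_Λ ≤ 1/√(2ν)`**, i.e.
`⟨ψ̄ψ⟩_Λ = 2N⟨σ_x⟩_Λ ≤ N√(2/ν)` — finite volume, every site. [cite: SalmhoferSeiler1991, Cor. 4.4 (1) (4.16) and (3) (4.18)] -/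
theorem expect_X_le_inv_sqrt (hν : 1 ≤ ν) (hL : Even L) (hL2 : 2 ≤ L) {N : ℕ} (hN : 1 ≤ N)
    {a w : ℕ → ℝ} (hlog : HasLog N a w) (ha0 : a 0 = 1) (hw1 : w 1 = 1)
    (hw : ∀ k, 2 ≤ k → k ≤ N → 0 ≤ w k) {m : ℝ} (hm : 0 ≤ m) (x : TorusSite ν L) :
    expect N m a (X x) ≤ 1 / Real.sqrt (2 * ν) := by
  have h := meanField_ineq hν hL hL2 hN hlog ha0 hw1 hw hm x
  have h0 := expect_X_nonneg hν hL hL2 hN hlog ha0 hw1 hw hm x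
  set s : ℝ := expect N m a (X x) with hs
  have hν0 : (0 : ℝ) < ν := by exact_mod_cast hν
  have h2 : 2 * ν * s ^ 2 ≤ 1 := by nlinarith
  have hsqrt : 0 < Real.sqrt (2 * ν) := Real.sqrt_pos.2 (by positivity)
  rw [le_div_iff₀ hsqrt]
  have hsq : (s * Real.sqrt (2 * ν)) ^ 2 ≤ 1 := by
    rw [mul_pow, Real.sq_sqrt (by positivity)]
    linarith
  exact (pow_le_one_iff_of_nonneg (mul_nonneg h0 hsqrt.le) two_ne_zero).1 hsq

/-- **(4.18), the mass branch: `2m⟨σ_x⟩_Λ ≤ 1`**, i.e. `⟨ψ̄ψ⟩_Λ = 2N⟨σ_x⟩_Λ ≤ N/m` for `m > 0`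
("the upper bound for `⟨ψ̄ψ⟩` by the mean field solution decreases with increasing mass `m`").
[cite: SalmhoferSeiler1991, Cor. 4.4 (3) (4.18)] -/
theorem two_mul_mass_mul_expect_X_le_one (hν : 1 ≤ ν) (hL : Even L) (hL2 : 2 ≤ L) {N : ℕ}
    (hN : 1 ≤ N) {a w : ℕ → ℝ} (hlog : HasLog N a w) (ha0 : a 0 = 1) (hw1 : w 1 = 1)
    (hw : ∀ k, 2 ≤ k → k ≤ N → 0 ≤ w k) {m : ℝ} (hm : 0 ≤ m) (x : TorusSite ν L) :
    2 * m * expect N m a (X x) ≤ 1 := by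
  have h := meanField_ineq hν hL hL2 hN hlog ha0 hw1 hw hm x
  nlinarith [sq_nonneg (expect N m a (X x))]

/-- **Cor. 4.4 (3) (4.18)**: `⟨ψ̄ψ⟩_Λ ≤ N min{√(2/ν), 1/m}` (`m > 0`), written for
`⟨ψ̄ψ(x)⟩ = 2N⟨σ_x⟩` (the dictionary (2.24)/Def. 3.3): `2N⟨σ_x⟩_Λ ≤ N · min (√(2/ν)) (1/m)`.
[cite: SalmhoferSeiler1991, Cor. 4.4 (3) (4.18)] -/
theorem condensate_le_min (hν : 1 ≤ ν) (hL : Even L) (hL2 : 2 ≤ L) {N : ℕ} (hN : 1 ≤ N)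
    {a w : ℕ → ℝ} (hlog : HasLog N a w) (ha0 : a 0 = 1) (hw1 : w 1 = 1)
    (hw : ∀ k, 2 ≤ k → k ≤ N → 0 ≤ w k) {m : ℝ} (hm : 0 < m) (x : TorusSite ν L) :
    2 * N * expect N m a (X x) ≤ N * min (Real.sqrt (2 / ν)) (1 / m) := by
  have hN0 : (0 : ℝ) ≤ N := Nat.cast_nonneg N
  have hν0 : (0 : ℝ) < ν := by exact_mod_cast hν
  have h1 := expect_X_le_inv_sqrt hν hL hL2 hN hlog ha0 hw1 hw hm.le x
  have h2 := two_mul_mass_mul_expect_X_le_one hν hL hL2 hN hlog ha0 hw1 hw hm.le x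
  have hsqrt : 2 * (1 / Real.sqrt (2 * ν)) = Real.sqrt (2 / ν) := by
    rw [Real.sqrt_div' 2 hν0.le, Real.sqrt_mul' 2 hν0.le]
    have h2pos : 0 < Real.sqrt 2 := Real.sqrt_pos.2 two_pos
    have hνs : 0 < Real.sqrt ν := Real.sqrt_pos.2 hν0
    field_simp
    rw [← Real.sqrt_mul_self two_pos.le, Real.sqrt_mul_self two_pos.le, Real.sq_sqrt two_pos.le]
  rw [mul_min_of_nonneg _ _ hN0]
  refine le_min ?_ ?_
  · calc 2 * N * expect N m a (X x) = N * (2 * expect N m a (X x)) := by ring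
      _ ≤ N * (2 * (1 / Real.sqrt (2 * ν))) := by
          exact mul_le_mul_of_nonneg_left (by linarith) hN0
      _ = N * Real.sqrt (2 / ν) := by rw [hsqrt]
  · calc 2 * N * expect N m a (X x) = N * (2 * m * expect N m a (X x)) / m := by
          field_simp
      _ ≤ N * 1 / m := by
          exact div_le_div_of_nonneg_right (mul_le_mul_of_nonneg_left h2 hN0) hm.le
      _ = N * (1 / m) := by ring

/-! ### The two printed models: NJL / strongly coupled QED, and `U(N)` -/

/-- The NJL system (`W(t) = t`, i.e. `w = δ_{k,1}`; strongly coupled QED is `N = 1`) has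
`B(t) = e^{Nt}`: its truncated bond data `a_k = N^k/k!` (Def. 3.3 (1)) satisfy `B = exp(NW)` to
order `N`. [cite: SalmhoferSeiler1991, Def. 3.3 (1) with (2.23)] -/
theorem hasLog_njl (N : ℕ) : HasLog N (njlBondCoeff N) (Pi.single 1 1) := by
  intro k hk1 _
  rw [Finset.sum_eq_single (1, k - 1)]
  · obtain ⟨j, rfl⟩ : ∃ j, k = j + 1 := ⟨k - 1, by omega⟩
    simp only [Pi.single_eq_same, njlBondCoeff, Nat.add_sub_cancel, Nat.cast_one, mul_one,
      one_mul, Nat.factorial_succ, pow_succ, Nat.cast_mul, Nat.cast_add]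
    have hj : (0 : ℝ) < (Nat.factorial j : ℝ) := by exact_mod_cast Nat.factorial_pos j
    field_simp
  · intro p hp hne
    have hp' : p.1 + p.2 = k := HasAntidiagonal.mem_antidiagonal.mp hp
    have hp1 : p.1 ≠ 1 := by
      intro h1
      apply hne
      ext
      · exact h1
      · show p.2 = k - 1
        omega
    rw [Pi.single_eq_of_ne hp1, mul_zero, zero_mul]
  · intro h
    exact absurd (HasAntidiagonal.mem_antidiagonal.mpr (by show 1 + (k - 1) = k; omega)) h

/-- **Theorem 4.3 (4.6) for the NJL system / strongly coupled lattice QED** (the model of the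
printed theorem): `2ν⟨σ_x⟩_Λ² + 2m⟨σ_x⟩_Λ ≤ 1` in every finite even volume, hence `⟨σ_x⟩_Λ ≤ s₁`.
[cite: SalmhoferSeiler1991, Thm. 4.3 (4.6)–(4.7)] -/
theorem njl_meanField_ineq (hν : 1 ≤ ν) (hL : Even L) (hL2 : 2 ≤ L) {N : ℕ} (hN : 1 ≤ N)
    {m : ℝ} (hm : 0 ≤ m) (x : TorusSite ν L) :
    2 * ν * expect N m (njlBondCoeff N) (X x) ^ 2 + 2 * m * expect N m (njlBondCoeff N) (X x) ≤ 1 :=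
  meanField_ineq hν hL hL2 hN (hasLog_njl N) (njlBondCoeff_zero N) (by simp)
    (fun k hk _ => by rw [Pi.single_eq_of_ne (by omega : k ≠ 1)]) hm x

/-- Theorem 4.3 (4.6) for the NJL system: `⟨σ_x⟩_Λ ≤ s₁ = (√(m² + 2ν) - m)/(2ν)`.
[cite: SalmhoferSeiler1991, Thm. 4.3 (4.6)–(4.7)] -/
theorem njl_expect_X_le_meanField (hν : 1 ≤ ν) (hL : Even L) (hL2 : 2 ≤ L) {N : ℕ} (hN : 1 ≤ N)
    {m : ℝ} (hm : 0 ≤ m) (x : TorusSite ν L) :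
    expect N m (njlBondCoeff N) (X x) ≤ (Real.sqrt (m ^ 2 + 2 * ν) - m) / (2 * ν) :=
  expect_X_le_meanField hν hL hL2 hN (hasLog_njl N) (njlBondCoeff_zero N) (by simp)
    (fun k hk _ => by rw [Pi.single_eq_of_ne (by omega : k ≠ 1)]) hm x

/-- **Theorem 4.3 (4.6) for the `U(N)` model, `1 ≤ N ≤ 4`** (Remark 4.6: `w₁ = 1`, `w_k ≥ 0`):
`2ν⟨σ_x⟩_Λ² + 2m⟨σ_x⟩_Λ ≤ 1` in every finite even volume. [cite: SalmhoferSeiler1991, Thm. 4.3 (4.6) with Remark 4.6 and Thm. 3.18] -/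
theorem uN_meanField_ineq (hν : 1 ≤ ν) (hL : Even L) (hL2 : 2 ≤ L) {N : ℕ} (hN1 : 1 ≤ N)
    (hN4 : N ≤ 4) {m : ℝ} (hm : 0 ≤ m) (x : TorusSite ν L) :
    2 * ν * expect N m (uNBondCoeff N) (X x) ^ 2 + 2 * m * expect N m (uNBondCoeff N) (X x) ≤ 1 :=
  meanField_ineq hν hL hL2 hN1 (hasLog_uN hN1 hN4) (uNBondCoeff_zero N) (uNLogCoeff_one N)
    (fun k hk2 hkN => uNLogCoeff_nonneg hN4 k hk2 hkN) hm x

/-- Theorem 4.3 (4.6) for the `U(N)` model, `1 ≤ N ≤ 4`: `⟨σ_x⟩_Λ ≤ s₁`.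
[cite: SalmhoferSeiler1991, Thm. 4.3 (4.6) with Remark 4.6 and Thm. 3.18] -/
theorem uN_expect_X_le_meanField (hν : 1 ≤ ν) (hL : Even L) (hL2 : 2 ≤ L) {N : ℕ} (hN1 : 1 ≤ N)
    (hN4 : N ≤ 4) {m : ℝ} (hm : 0 ≤ m) (x : TorusSite ν L) :
    expect N m (uNBondCoeff N) (X x) ≤ (Real.sqrt (m ^ 2 + 2 * ν) - m) / (2 * ν) :=
  expect_X_le_meanField hν hL hL2 hN1 (hasLog_uN hN1 hN4) (uNBondCoeff_zero N) (uNLogCoeff_one N)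
    (fun k hk2 hkN => uNLogCoeff_nonneg hN4 k hk2 hkN) hm x

end ComplexSpin

end Literature.MathematicalPhysics.StatisticalMechanics

end
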